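import Summits.HodgeConjecture.HodgeConjecture.Theorems.HodgeProjectorDivisorSupportHodgeProjectorDivisorSupportedIntegralProjectorCycle
import Literature.AlgebraicGeometry.HodgeTheory.CycleClassPushforward
import Literature.AlgebraicGeometry.HodgeTheory.ComplexOrientationDegreeFormulaHolds
import Literature.AlgebraicGeometry.HodgeTheory.SupportedHodgeClassesAlgebraic
import Literature.AlgebraicGeometry.HodgeTheory.SaitoGrFDeRhamCurveNetHolds
import Literature.AlgebraicGeometry.HodgeTheory.CanonicalTrace
import Literature.AlgebraicGeometry.HodgeTheory.ComplexOrientationFamily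
import Literature.AlgebraicGeometry.Resolution.ProjectiveResolutionProofs
import HarnessLib

/-!
# Crux `HodgeProjectorDivisorSupported` (stmt-HodgeConjecture-18704), line `birth` — STUB K
# `stub_algebraicClasses_le_span_cycleClass` (PURITY): ALGEBRAIC CLASSES ARE SPANNED BY CYCLE CLASSES

Route `HodgeConjecture/HodgeProjectorDivisorSupport`; registered skeleton
`Cruxes/HodgeProjectorDivisorSupported/Lines/birth.lean` (stubs K, D, H; `HodgeProjectorDivisorSupported_of`).
Stub D is the tree's `HodgeProjectorDivisorSupported.stub_integralProjectorCycle` (ring2-b02 gen 41); this file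
closes STUB K, for every smooth projective `X` of dimension `n = d + e` and EVERY resolution family `ρ` in
dimension `d`:

  `Nᵉ H^{2e}(X(ℂ); ℂ) = algebraicClasses X e ⊆ span_ℂ {cycleClass complexOrientationFamily hX hde ρ Z | Z ∈ Z_d(X)}`.

Proof (Fulton §19.1 eq. (1) / Voisin I §11.1.2–11.1.4 on the tree's carriers).  A class of `Nᵉ` dies off a
Zariski-closed `Z` of codimension `≥ e` (`exists_support_of_mem_supportedClasses`); resolve the components
`Z = ⋃ⱼ gⱼ(Yⱼ)`, `dim Yⱼ ≤ d` (`exists_family_iUnion_range_eq_of_isClosed`, projective Hironaka — a theorem);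
Deligne's Cor. 8.2.8 (`Deligne1974_ker_restrictCompl_eq_iSup_range_complexGysin_holds`) writes the class as
`Σⱼ (gⱼ)_* yⱼ` with `deg yⱼ = 2e + 2 dim Yⱼ − 2n`, forcing `dim Yⱼ = d`, `yⱼ ∈ H⁰(Yⱼ(ℂ); ℂ) = ℂ · 1`; and
`(gⱼ)_* 1` is `[κ(η) : κ(gⱼ η)] · [closure {gⱼ η}]_ρ` when `gⱼ` preserves the dimension (Fulton's DEGREE FORMULA
for the complex orientations, the tree's theorem `Fulton1998_degreeFormula_complexOrientation_holds`, through
`complexGysin_one_eq_smul_cycleClass`) and `0` otherwise (semipurity, `complexGysin_one_eq_zero_of_height_lt`).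

With STUB K and STUB D discharged the crux is exactly STUB H:
`hodgeProjectorDivisorSupported_of_crossDecomposition : <STUB H signature> → HodgeProjectorDivisorSupported`.
No definition, no named-fact hypothesis, no sorry.

References: [Fulton1998] §1.4, Lemma 19.1.2, §19.1 eq. (1); [VoisinHodgeI2002] §11.1.2 Lemma 11.13, §11.1.4;
[DeligneHodgeIII1974] Cor. 8.2.8; [Kollar2007] Thm. 3.27.
-/

noncomputable section

-- every declaration of this problem lives in `Summit.HodgeConjecture.HodgeConjecture.…` (summit = sub-problem)
set_option linter.dupNamespace false

open CategoryTheory AlgebraicGeometry MonoidalCategory CartesianMonoidalCategory Order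
open Literature.AlgebraicGeometry Literature.AlgebraicGeometry.Motives Literature.AlgebraicGeometry.HodgeTheory
open Literature.AlgebraicTopology.SingularHomology

namespace Summit.HodgeConjecture.HodgeConjecture.Theorems.HodgeProjectorDivisorSupported

variable {n : ℕ} {X : SchemeOver ℂ}

/-- **`g_* 1` lies in the span of the cycle classes** (complex orientations): for `g : Y ⟶ X` from a smooth
projective `d`-fold `Y` into the smooth projective `n`-fold `X`, `n = d + e`, and any resolution family `ρ` of `X`
in dimension `d`, the Gysin image `g_* 1 ∈ H^{2e}(X(ℂ); ℂ)` is `k · [closure {g η}]_ρ`, `k = [κ(η) : κ(g η)] ≥ 1`,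
if `g` preserves the dimension of the generic point `η` (degree formula), and `0` if it drops it (semipurity).
[cite: Fulton1998, §1.4 and Lemma 19.1.2] [cite: VoisinHodgeI2002, §11.1.2 Lemma 11.13 and §11.1.4] -/
theorem complexGysin_one_mem_span_cycleClass (hX : IsSmoothProjective n X) {d e : ℕ} (hde : d + e = n)
    (ρ : ResolutionFamily X d) {Y : SchemeOver ℂ} (hY : IsSmoothProjective d Y) (g : Y ⟶ X) :
    complexGysin complexOrientationFamily hY hX g (show 0 + 2 * n = 2 * e + 2 * d by omega)
        (singularCohomology.one ℂ (ComplexPoints Y)) ∈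
      Submodule.span ℂ (Set.range (cycleClass complexOrientationFamily hX hde ρ)) := by
  have hμ : complexOrientationFamily.HasDegreeFormula := Fulton1998_degreeFormula_complexOrientation_holds
  haveI : IsIntegral Y.left := IsSmoothProjective.isIntegral_holds hY
  haveI := isProper_left_of_isSmoothProjective hY hX g
  haveI : QuasiCompact g.left := inferInstance
  have hf : IsClosedMap g.left.base := g.left.isClosedMap
  have hη : IsGenericPoint (genericPoint Y.left) Set.univ := genericPoint_spec Y.left
  have hy : height (genericPoint Y.left) = (d : ℕ∞) := height_eq_of_isGenericPoint hY hη
  by_cases hdim : height (g.left.base (genericPoint Y.left)) = height (genericPoint Y.left)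
  · -- dimension preserved: degree formula with `k = [κ(η) : κ(g η)] ≥ 1`
    have hk : 0 < AlgebraicCycle.mapCoeff g.left height height (genericPoint Y.left) :=
      Nat.pos_of_ne_zero (mapCoeff_ne_zero_of_height_eq_of_isSmoothProjective hY hX g _ hy
        (by rw [hdim, hy]))
    have hmem' : Motives.primeCycle (g.left.base (genericPoint Y.left)) ∈ Motives.cyclesOfDim X.left d :=
      Motives.primeCycle_mem_cyclesOfDim (by rw [hdim, hy])
    have hmap : AlgebraicCycle.map g.left height height (Motives.primeCycle (genericPoint Y.left)) =
        AlgebraicCycle.mapCoeff g.left height height (genericPoint Y.left) •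
          Motives.primeCycle (g.left.base (genericPoint Y.left)) := by
      rw [Motives.algebraicCycleMap_primeCycle_eq_nsmul]
    rw [complexGysin_one_eq_smul_cycleClass hμ hX hde ρ hY g hη hk hmap hmem']
    exact Submodule.smul_mem _ _ (Submodule.subset_span ⟨_, rfl⟩)
  · -- dimension drops: the Gysin image vanishes
    have hlt : height (g.left.base (genericPoint Y.left)) < (d : ℕ∞) := by
      have hle := Motives.height_base_le_of_isClosedMap g.left hf (genericPoint Y.left)
      rw [hy] at hle hdim
      exact lt_of_le_of_ne hle hdim
    rw [complexGysin_one_eq_zero_of_height_lt complexOrientationFamily hY hX g hde _ hη hlt]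
    exact Submodule.zero_mem _

/-- **One Gysin piece of the Deligne decomposition lies in the span of the cycle classes**: for
`g : Y ⟶ X`, `Y` smooth projective of dimension `m = d` (the degree count of the caller), every Gysin image
`g_* y`, `y ∈ H⁰(Y(ℂ); ℂ) = ℂ · 1`, is a multiple of `g_* 1`. [cite: VoisinHodgeI2002, §11.1.4]
[cite: HatcherAT2002, §3.1 p. 199] -/
theorem complexGysin_mem_span_cycleClass (hX : IsSmoothProjective n X) {d e : ℕ} (hde : d + e = n)
    (ρ : ResolutionFamily X d) {m : ℕ} {Y : SchemeOver ℂ} (hY : IsSmoothProjective m Y) (g : Y ⟶ X)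
    (hm : m = d) {a : ℕ} (hab : a + 2 * n = 2 * e + 2 * m) (y : complexBetti Y a) :
    complexGysin complexOrientationFamily hY hX g hab y ∈
      Submodule.span ℂ (Set.range (cycleClass complexOrientationFamily hX hde ρ)) := by
  subst hm
  obtain rfl : a = 0 := by omega
  obtain ⟨t, rfl⟩ := exists_eq_smul_one_of_isSmoothProjective hY ℂ y
  rw [map_smul]
  exact Submodule.smul_mem _ _ (complexGysin_one_mem_span_cycleClass hX hde ρ hY g)

/-- **STUB K `stub_algebraicClasses_le_span_cycleClass` of crux `HodgeProjectorDivisorSupported`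
(stmt-HodgeConjecture-18704; REGISTERED signature, verbatim) — PURITY: algebraic classes are spanned by cycle
classes.**  For `X` smooth projective of dimension `n = d + e` and every resolution family `ρ` in dimension `d`,
`Nᵉ H^{2e}(X(ℂ); ℂ) ⊆ span_ℂ {[Z]_ρ | Z ∈ Z_d(X)}`: support of codimension `≥ e`, projective Hironaka on its
components, Deligne's Cor. 8.2.8, the degree count `dim Yⱼ = d`, `H⁰ = ℂ · 1`, and Fulton's degree formula for
the complex orientations (all theorems of the tree). [cite: Fulton1998, §19.1 eq. (1) and Lemma 19.1.1]
[cite: VoisinHodgeI2002, §11.1.2 and §11.1.4] [cite: DeligneHodgeIII1974, Cor. 8.2.8] [cite: Kollar2007, Thm. 3.27] -/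
theorem stub_algebraicClasses_le_span_cycleClass :
    ∀ ⦃n d e : ℕ⦄ ⦃X : SchemeOver ℂ⦄ (hX : IsSmoothProjective n X) (hde : d + e = n)
      (ρ : ResolutionFamily X d),
      algebraicClasses X e ≤
        Submodule.span ℂ (Set.range (cycleClass complexOrientationFamily hX hde ρ)) := by
  intro n d e X hX hde ρ c hc
  -- one closed support of codimension `≥ e`
  obtain ⟨Z, hZ, hZe, hcZ⟩ := exists_support_of_mem_supportedClasses hc
  -- resolve its components: `Z = ⋃ⱼ gⱼ(Yⱼ)`, `dim Yⱼ + e ≤ n`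
  obtain ⟨ι, hι, m, Y, hY, g, hZeq, hm⟩ :=
    exists_family_iUnion_range_eq_of_isClosed Resolution.Hironaka1964_projective_holds hX hZ hZe
  haveI := hι
  subst hZeq
  -- Deligne: `c ∈ Σⱼ im (gⱼ)_*` for the complex orientation family
  have hmem := Deligne1974_ker_restrictCompl_eq_iSup_range_complexGysin.mem_iSup_range
    Deligne1974_ker_restrictCompl_eq_iSup_range_complexGysin_holds complexOrientationFamily
    hasPoincareDuality_complexOrientationFamily hX hY g hcZ
  refine SetLike.le_def.mp (iSup_le fun j ↦ iSup_le fun a ↦ iSup_le fun hab ↦ ?_) hmem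
  rintro _ ⟨y, rfl⟩
  have hmj : m j = d := by have := hm j; omega
  exact complexGysin_mem_span_cycleClass hX hde ρ (hY j) (g j) hmj hab y

/-- **The crux from STUB H alone.** With STUB K (this file) and STUB D (`stub_integralProjectorCycle`, landed)
discharged, `HodgeProjectorDivisorSupported` follows from the registered STUB H `stub_crossDecomposition`
(signature verbatim as hypothesis), by the landed composition
`hodgeProjectorDivisorSupported_of_purity_of_crossDecomposition`. [cite: Fulton1998, §19.1]
[cite: VoisinHodgeI2002, §11.1.4] -/
theorem hodgeProjectorDivisorSupported_of_crossDecomposition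
    (hH : ∀ (n : ℕ) (X : SchemeOver ℂ) (hX : IsSmoothProjective (2 * n) X)
      (ρ : ResolutionFamily (X ⊗ X) (2 * n)), 1 ≤ n →
      ∀ (Z : ↥(cyclesOfDim (X ⊗ X).left (2 * n))) (u : ℂ), u ≠ 0 →
        (∀ c : complexBetti X (2 * n), IsRationalClass c → IsOfHodgeType (2 * n) X (2 * n) n n c →
          corrAction complexOrientationFamily hX hX
            (rfl : 2 * n + 2 * (2 * n) = 2 * n + 2 * (2 * n))
            (cycleClass complexOrientationFamily (IsSmoothProjective.tensor_holds hX hX)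
              (rfl : 2 * n + 2 * n = 2 * n + 2 * n) ρ Z) c = u • c) →
        (∀ b : complexBetti X (2 * n),
          (∀ a : complexBetti X (2 * n), IsRationalClass a → IsOfHodgeType (2 * n) X (2 * n) n n a →
            cupProduct (rfl : 2 * n + 2 * n = 2 * n + 2 * n) a b = 0) →
          corrAction complexOrientationFamily hX hX
            (rfl : 2 * n + 2 * (2 * n) = 2 * n + 2 * (2 * n))
            (cycleClass complexOrientationFamily (IsSmoothProjective.tensor_holds hX hX)
              (rfl : 2 * n + 2 * n = 2 * n + 2 * n) ρ Z) b = 0) →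
        ∃ D : Set X.left, IsClosed D ∧ D ≠ Set.univ ∧
          ∃ (Z' Z'' : ↥(cyclesOfDim (X ⊗ X).left (2 * n))) (m : ℕ), 0 < m ∧
            (∀ z, (Z' : AlgebraicCycle (X ⊗ X).left ℤ) z ≠ 0 → (fst X X).left.base z ∈ D) ∧
            (∀ z, (Z'' : AlgebraicCycle (X ⊗ X).left ℤ) z ≠ 0 → (snd X X).left.base z ∈ D) ∧
            ∀ c : complexBetti X (2 * n),
              corrAction complexOrientationFamily hX hX
                  (rfl : 2 * n + 2 * (2 * n) = 2 * n + 2 * (2 * n))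
                  (cycleClass complexOrientationFamily (IsSmoothProjective.tensor_holds hX hX)
                    (rfl : 2 * n + 2 * n = 2 * n + 2 * n) ρ (Z' + Z'')) c =
                (m : ℂ) • corrAction complexOrientationFamily hX hX
                  (rfl : 2 * n + 2 * (2 * n) = 2 * n + 2 * (2 * n))
                  (cycleClass complexOrientationFamily (IsSmoothProjective.tensor_holds hX hX)
                    (rfl : 2 * n + 2 * n = 2 * n + 2 * n) ρ Z) c) :
    Summit.HodgeConjecture.HodgeConjecture.Theses.HodgeProjectorDivisorSupport.HodgeProjectorDivisorSupported :=
  hodgeProjectorDivisorSupported_of_purity_of_crossDecomposition stub_algebraicClasses_le_span_cycleClass hH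

end Summit.HodgeConjecture.HodgeConjecture.Theorems.HodgeProjectorDivisorSupported

end
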